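import Summits.BirchSwinnertonDyer.Rank1Residual.X2.LocalInertiaCohomologyMultiplicativeVanishing
import Summits.BirchSwinnertonDyer.Rank1Residual.X2.NonPrimitiveQuotientCorank
import Summits.BirchSwinnertonDyer.Rank1Residual.Iwasawa.InertiaCohomologyPTorsionFinite
import Literature.NumberTheory.EllipticCurves.TateUniformisation
import Literature.NumberTheory.Automorphic.AdicCompletionResidueCard
import Literature.NumberTheory.EllipticCurves.HasseWeilAbelianBadReduction
import Literature.NumberTheory.EllipticCurves.KellerYin2024.AnticyclotomicLocalEulerFactors
import HarnessLib

/-!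
# The `f`-side per-place bound at a SPLIT MULTIPLICATIVE place `w ∤ p` over a number field:
# `zpCorank Y ≤ 𝟙[Nw ≡ 1 (mod p)]` for the subgroups `Y` of the image of
# `H¹(K_∞, E[p^∞]) → H¹(I_w(K_∞), E[p^∞])` (Greenberg–Vatsal Prop. (2.4), inertia side, over `K`)

Cell `bsd-eis` (home `run/shared/lean/pub/bsd-eis/`), seat `bsd-line-x1-p1-w2` (D-0154 width seat on
crux 2 `GoodLatticeBDPValue` = stmt-BirchSwinnertonDyer-19032, line `halves` v14, stub
`stub_imprimCorank`, `f`-side conjunct `rem142_goodLattice_selmerAc_imprimitive`), file F3b-split of the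
unconditional `≤`-half: the per-place input `c_w` of `SelmerAcQuotientCorankOfLoc.zpCorank_selmerAc_quotient_le_sum_of_loc`
(p612280) at a place `w ∤ p` of SPLIT multiplicative reduction of an elliptic curve `W` over a number
field `K` (for the crux: `W = E ×_ℚ K` at a split `w ∣ ℓ ‖ N_E` with `E` split multiplicative at `ℓ`).
It is the `K`-general re-run of the split branch of b2b X2 `NonPrimitiveLambdaShiftRat.zpCorank_le_dMultiplicity`
(written over `ℚ`): the Tate parametrisation `Φ` of `Silverman1994_thmV53_tateUniformisation` (a named
PUBLISHED fact, stated for every number field; hypothesis `hT`) is untwisted at a split place (`t = 0`,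
`GreenbergVatsalTateDatumSign.sign_of_equivariant`), so `#H¹(I_w(K_∞), E[p^∞])[p] ≤ p`
(`LocalInertiaCohomologyMultiplicative.natCard_torsionBy_discreteH1_inertiaIn_le`) gives `≤ 1`, and for
`Nw ≢ 1 (mod p)` the image has no `p`-torsion
(`…MultiplicativeVanishing.resH1Hom_inertiaIn_eq_zero_of_prime_nsmul_eq_zero_kerSubgroup`, the
prime-to-`p` part of Frobenius acting on `E[p^∞]/C` trivially and on the Kummer classes by `q_w = Nw`).
Since `P_w(X) = 1 − X` at a split multiplicative place (`localPolynomialAt_of_hasSplitMultiplicativeReductionAt`),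
`𝟙[Nw ≡ 1] = rootMultiplicity((Nw)⁻¹, P̃_w)`, the `curveLocalLambda` recipe — that bookkeeping and the
NON-split places (`P_w = 1 + X`, twist by `√γ` over `K_w`) are left to the sequel.

* `zpCorank_le_of_hasSplitMultiplicativeReductionAt` — the per-place bound;
* `curveLocalLambda_of_hasSplitMultiplicativeReductionAt` — the bookkeeping `curveLocalLambda κ W w =
  numPlacesAbove κ w · 𝟙[Nw ≡ 1 (mod p)]` at a split multiplicative `w` (`P_w = 1 − X`, simple root `X = 1`).

HONEST FRAMING: tool theorem only (no definition, no named fact introduced — `hT` is the tree's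
existing Tate-uniformisation fact taken as a hypothesis, D-0014), no `sorry`; closes nothing by itself
(`--supports stmt-BirchSwinnertonDyer-19032`); BSD / Mazur's main conjecture is proved for no curve.

References: Greenberg–Vatsal 2000 §2 Prop. (2.4) pp. 22–23, pp. 14–15; Silverman ATAEC V.3.1, V.5.2–5.4;
Castella–Grossi–Lee–Skinner 2022 L893–901 (`𝒫_w(E)`); Keller–Yin §1.5 (L1337–1341).
-/

-- `Summit.BirchSwinnertonDyer.BirchSwinnertonDyer.…`: summit and sub-problem share a name (D-0017 layout).
set_option linter.dupNamespace false
set_option autoImplicit false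

noncomputable section

open scoped Classical AddSubgroup

open CategoryTheory Function NumberField IsDedekindDomain Field ValuativeRel
open Literature.NumberTheory.EllipticCurves Literature.NumberTheory.EllipticCurves.GreenbergSelmer
  Literature.NumberTheory.GaloisRepresentations
  Literature.NumberTheory.GaloisRepresentations.IsNonarchimedeanLocalField
  Summit.BirchSwinnertonDyer.Rank1Residual Summit.BirchSwinnertonDyer.Rank1Residual.X2
  Summit.BirchSwinnertonDyer.Rank1Residual.X2.NonPrimitiveQuotientCorank

namespace Summit.BirchSwinnertonDyer.BirchSwinnertonDyer.Theorems.SelmerAcSplitMultiplicativePlace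

variable {K : Type} [Field K] [NumberField K] {p : ℕ} [hp : Fact p.Prime]

/-- **At a SPLIT MULTIPLICATIVE `w ∤ p` every subgroup `Y` of the image of
`r_w : H¹(K_∞, E[p^∞]) → H¹(I_w(K_∞), E[p^∞])` has `zpCorank Y p ≤ 𝟙[Nw ≡ 1 (mod p)]`** (`p` odd, any
`ℤ_p`-extension `κ` of the number field `K`, any elliptic `W/K`; granted Tate's uniformisation `hT`).
`≤ 1`: `#H¹(I_w, E[p^∞])[p] ≤ p` from the untwisted Tate datum; `= 0` when `p ∤ Nw − 1`: the image of
`r_w` has no `p`-torsion (prime-to-`p` part of a Frobenius lies in `ker κ` and acts on the Kummer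
classes by `q_w = Nw ≢ 1 = a_w`). The split case of GV Prop. (2.4) (`corank 𝓗_ℓ = s_ℓ d_ℓ`, `d_ℓ =
𝟙[ℓ ≡ a_ℓ]`) per place of `K_∞`, over a number field.
[cite: GreenbergVatsal2000, §2 Prop. (2.4) pp. 22–23 and pp. 14–15]
[cite: SilvermanATAEC1994, Ch. V Lemma 5.2 (c), Thm. 5.3 (a),(b)] -/
theorem zpCorank_le_of_hasSplitMultiplicativeReductionAt
    (hT : Silverman1994_thmV53_tateUniformisation.{0}) (W : WeierstrassCurve K) [W.IsElliptic]
    (hp2 : p ≠ 2) (κ : ZpExtension K p) {w : HeightOneSpectrum (𝓞 K)}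
    (hpw : ((p : ℕ) : 𝓞 K) ∉ w.asIdeal) (hsplit : W.HasSplitMultiplicativeReductionAt w)
    (Y : AddSubgroup (discreteH1 (inertiaIn κ.kerSubgroup w) (W.geomPrimaryTorsion p)))
    (hY : ∀ y ∈ Y, ∃ c : subgroupH1 κ.kerSubgroup (W.geomPrimaryTorsion p),
      resH1Hom (inertiaInToH κ.kerSubgroup w) (AddMonoidHom.id (W.geomPrimaryTorsion p))
        (fun _ _ ↦ rfl) c = y) :
    zpCorank Y p ≤ if (w.asIdeal.absNorm : ZMod p) = 1 then 1 else 0 := by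
  have hIH : inertia (K := K) w ≤ κ.kerSubgroup := Iwasawa.inertia_le_kerSubgroup' κ w hpw
  have hsplit' : ((W.baseChange (w.adicCompletion K)).minimal
      (w.adicCompletionIntegers K)).HasSplitMultiplicativeReduction (w.adicCompletionIntegers K) := hsplit
  have hmult : W.HasMultiplicativeReductionAt w := hsplit'.toHasMultiplicativeReduction
  -- the residue cardinality `q_w = Nw`
  have hq : (residueFieldCard (w.adicCompletion K) : ℤ) = (w.asIdeal.absNorm : ℤ) := by
    rw [Literature.NumberTheory.Automorphic.residueFieldCard_adicCompletion_eq,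
      w.residueCard_eq_card_quotient, Ideal.absNorm_apply, Submodule.cardQuot_apply]
  -- the untwisted Tate datum at a split place (`t = 0`)
  obtain ⟨q, Φ, hq0, hq1, hsurj, hker, hΦσ, -⟩ := hT W w hsplit
  have hker' : ∀ u : (AlgebraicClosure (w.adicCompletion K))ˣ, Φ (Additive.ofMul u) = 0 →
      ∃ a : ℤ, (u : AlgebraicClosure (w.adicCompletion K)) =
        algebraMap (w.adicCompletion K) (AlgebraicClosure (w.adicCompletion K)) q ^ a :=
    fun u h ↦ (hker u).1 h
  have hΨσ := GreenbergVatsalTateDatumSign.sign_of_equivariant W Φ hΦσ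
  have ht : ∀ σ ∈ absInertia (w.adicCompletion K),
      Field.absoluteGaloisGroup.toAlgEquiv (w.adicCompletion K) σ
        (0 : AlgebraicClosure (w.adicCompletion K)) = 0 := fun σ _ ↦ map_zero _
  have ht2 : (0 : AlgebraicClosure (w.adicCompletion K)) ^ 2 =
      algebraMap (w.adicCompletion K) (AlgebraicClosure (w.adicCompletion K)) 0 := by
    rw [map_zero, zero_pow two_ne_zero]
  obtain ⟨hfin, hcard⟩ :=
    LocalInertiaCohomologyMultiplicative.natCard_torsionBy_discreteH1_inertiaIn_le W p Φ 0 hΨσ hsurj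
      hq0 hq1 hker' ht hpw κ.kerSubgroup hmult hIH
  split_ifs with hd
  · -- `≤ 1`: `Y[p] ↪ H¹(I_w, E[p^∞])[p]`, of order `≤ p`
    haveI := hfin
    let j : (↥Y)[(p : ℤ)] →
        (discreteH1 (inertiaIn κ.kerSubgroup w) (W.geomPrimaryTorsion p))[(p : ℤ)] :=
      fun y ↦ ⟨((y : Y) : _), by
        rw [AddSubgroup.torsionBy.nsmul_iff, ← AddSubmonoidClass.coe_nsmul,
          AddSubgroup.torsionBy.nsmul_iff.1 y.2, ZeroMemClass.coe_zero]⟩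
    have hj : Function.Injective j := fun a b hab ↦ by
      have h := congrArg Subtype.val hab
      exact Subtype.ext (Subtype.ext h)
    haveI : Finite ((↥Y)[(p : ℤ)]) := Finite.of_injective j hj
    exact zpCorank_le_one_of_natCard_torsionBy_le ((Nat.card_le_card_of_injective j hj).trans hcard)
  · -- `= 0`: `Nw ≢ 1 (mod p)`, no `p`-torsion in the image of `r_w`
    obtain ⟨φ, hφ⟩ := exists_isFrobPow_holds (F := w.adicCompletion K) 1
    have hcong : ¬ ((p : ℤ) ∣ (residueFieldCard (w.adicCompletion K) : ℤ) -
        (if Field.absoluteGaloisGroup.toAlgEquiv (w.adicCompletion K) φ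
          (0 : AlgebraicClosure (w.adicCompletion K)) = 0 then 1 else -1)) := by
      rw [if_pos (map_zero _), hq]
      intro hdvd
      apply hd
      have h := (ZMod.intCast_eq_intCast_iff_dvd_sub (1 : ℤ) (w.asIdeal.absNorm : ℤ) p).mpr hdvd
      push_cast at h
      exact h.symm
    refine le_of_eq (zpCorank_eq_zero_of_torsionBy_trivial fun y hpy ↦ ?_)
    obtain ⟨c, hc⟩ := hY _ y.2
    have hpc : p • resH1Hom (inertiaInToH κ.kerSubgroup w) (AddMonoidHom.id (W.geomPrimaryTorsion p))
        (fun _ _ ↦ rfl) c = 0 := by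
      rw [hc, ← AddSubmonoidClass.coe_nsmul, hpy, ZeroMemClass.coe_zero]
    apply Subtype.ext
    rw [ZeroMemClass.coe_zero, ← hc]
    exact LocalInertiaCohomologyMultiplicative.resH1Hom_inertiaIn_eq_zero_of_prime_nsmul_eq_zero_kerSubgroup
      W p Φ 0 hΨσ hsurj hq0 hq1 hker' ht hpw κ hp2 hmult hIH ht2 hφ hcong c hpc

/-- **`λ(𝒫_w(f)) = [Γ : Γ_w] · 𝟙[Nw ≡ 1 (mod p)]` at a SPLIT multiplicative place**: there
`P_w(X) = 1 − X` (`localPolynomialAt_of_hasSplitMultiplicativeReductionAt`, Silverman C.16), whose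
reduction has the simple root `X = 1`, so `rootMultiplicity((Nw)⁻¹, P̃_w) = 𝟙[(Nw)⁻¹ = 1] = 𝟙[Nw = 1]`
in `𝔽_p` — the `f`-side local `λ`-value of KY §1.5 / CGLS L893–901 (`𝒫_w(E) = 1 − ℓ⁻¹γ_w` up to a
unit) matches the per-place bound `zpCorank_le_of_hasSplitMultiplicativeReductionAt` on the nose.
[cite: KellerYin2024, §1.5 (arXiv:2402.12781v2 TeX L1337–1341)] [cite: SilvermanAEC2009, §C.16 (PDF p. 390)] -/
theorem curveLocalLambda_of_hasSplitMultiplicativeReductionAt (κ : ZpExtension K p) (W : WeierstrassCurve K)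
    {w : HeightOneSpectrum (𝓞 K)} (hsplit : W.HasSplitMultiplicativeReductionAt w) :
    KellerYin2024.curveLocalLambda κ W w =
      KellerYin2024.numPlacesAbove κ w * (if (w.asIdeal.absNorm : ZMod p) = 1 then 1 else 0) := by
  rw [KellerYin2024.curveLocalLambda_eq]
  congr 1
  have hP : GreenbergVatsal2000.eulerFactorModP W p w = 1 - Polynomial.X := by
    unfold GreenbergVatsal2000.eulerFactorModP
    rw [WeierstrassCurve.localPolynomialAt_of_hasSplitMultiplicativeReductionAt hsplit, Polynomial.map_sub,
      Polynomial.map_one, Polynomial.map_X]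
  rw [hP]
  have hfac : (1 - Polynomial.X : Polynomial (ZMod p)) = Polynomial.C (-1) * (Polynomial.X - Polynomial.C 1) := by
    rw [map_neg, map_one, neg_one_mul, neg_sub]
  split_ifs with h1
  · rw [h1, inv_one, hfac, Polynomial.rootMultiplicity_mul, Polynomial.rootMultiplicity_C,
      Polynomial.rootMultiplicity_X_sub_C_self]
    rw [← hfac]
    intro h
    have h0 := congrArg (Polynomial.eval 0) h
    rw [Polynomial.eval_sub, Polynomial.eval_one, Polynomial.eval_X, sub_zero, Polynomial.eval_zero] at h0
    exact one_ne_zero h0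
  · refine Polynomial.rootMultiplicity_eq_zero fun hroot ↦ h1 ?_
    rw [Polynomial.IsRoot, Polynomial.eval_sub, Polynomial.eval_one, Polynomial.eval_X, sub_eq_zero] at hroot
    exact inv_eq_one.mp hroot.symm

end Summit.BirchSwinnertonDyer.BirchSwinnertonDyer.Theorems.SelmerAcSplitMultiplicativePlace

end
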